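import Mathlib
import HarnessLib
import Summits.Ventures.LatticeQCDFlow.Scaling.AutoregressiveProposalAcceptance
import Literature.NumberTheory.Automorphic.AutomorphicRepsGLLogDetCounterexample

/-!
# LatticeQCDFlow / Scaling — THE KL CHAIN RULE for an autoregressive proposal: the forward training
# loss of the hybrid is EXACTLY the sum over the block of the mean conditional divergences, each ≥ 0

HONEST FRAMING: exact (Metropolis-corrected) sampling algorithms for lattice gauge theory;
figures of merit are autocorrelation/cost numbers at stated couplings and volumes; no
continuum-physics claim.

Venture `LatticeQCDFlow` (cell pub-lqcd), topic `Scaling`, FANOUT row 30 (lean-1, GEN-19) — OUR WORK,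
companion of `Scaling/AutoregressiveProposalAcceptance` (`L¹` necessity) and
`Scaling/AutoregressiveProposalAcceptanceChain` (`L¹` sufficiency, errors add at most linearly).  In
relative entropy the bookkeeping is EXACT and — through the tree's general-space floor
`acc ≥ ½e^{−2D(p‖q)}` (`Scaling/AcceptanceKLFloorIntegral`, row 3) — MULTIPLICATIVE in the block:
the currency for VOLUME scaling (a per-link mean conditional divergence `κ` over `V` links costs at most
a factor `e^{−2Vκ}` of acceptance).

## Setting

`π = ⊗_ι μ` (`μ` a probability measure), target weight `F` with `0 < c_F ≤ F ≤ C_F`, `Z = ∫F dπ`;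
a block `l = [a₁,…,a_m]` in generation order with measurable conditionals `0 < c_q ≤ q_{a_k} ≤ C_q`,
normalised in `a_k`, not reading `a_{k+1},…,a_m` (`l.Pairwise`); `s_k = {a_{k+1},…,a_m}`,
`N_k = A_{s_k} F` (so `N_m = F`, `N_0 = A_{s_0}F`); the hybrid proposal `H = (∏_k q_{a_k})·N_0/Z`
(context exact, block from the model; the model itself when `l` lists every coordinate).

## What is proved (all [ours])

* §0 helpers (`|log x| ≤ x + x⁻¹` is the tree's `Literature…abs_log_le_add_inv`): integrability of `(F/Z)·log g` for squeezed `g`; list sums under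
  the integral; blindness bookkeeping along `l.zip l.tails.tail`.
* §1 `log_arHybrid_telescope` — pointwise `log(F/((∏_k q_{a_k})·N_0)) = Σ_k log(N_k/(q_{a_k}·N_{k−1}))`.
* §2 **`integral_condKL_nonneg`** — each summand is a MEAN CONDITIONAL DIVERGENCE and is `≥ 0`:
  `0 ≤ ∫ (F/Z)·log(A_s F/(q·A_{insert a s}F)) dπ` for `q` normalised in `a` and blind to `s`
  (`log x ≤ x − 1`; `A_s` is the conditional expectation; the normalised factor integrates away — the
  three toolbox identities of the parent file).
* §3 **`integral_kl_arHybrid_eq_sum`** — THE CHAIN RULE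
  `∫ (F/Z)·log((F/Z)/H) dπ = Σ_k ∫ (F/Z)·log(N_k/(q_{a_k}·N_{k−1})) dπ`;
  `integral_kl_arHybrid_nonneg` — the total is `≥ 0`.

READING (value-free): the forward loss `D(p‖H)` of an autoregressive proposal decomposes additively and
exactly over the generation order into per-coordinate mean conditional divergences; with row 3's floor
the exact sampler accepts at rate `≥ ½·exp(−2Σ_k κ_k)` (companion file, once both parents are built).
NOT CLAIMED: the reverse loss `D(H‖p)` (its chain rule weights by the MODEL context law); anything on
autocorrelations.  No `def`, no `sorry`, nothing cited as a fact.
-/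

noncomputable section

namespace Summit.Ventures.LatticeQCDFlow.Theory2.Autoregressive

open MeasureTheory Function Set
open Summit.Ventures.LatticeQCDFlow.Exactness

variable {ι : Type*} [Fintype ι] [DecidableEq ι] {X : Type*} [MeasurableSpace X]
variable (μ : Measure X) [IsProbabilityMeasure μ]

/-! ## §0 Helpers -/

/-- Squeezed weights have squeezed, hence positive, partial averages. [ours] -/
theorem coordAvg_pos_of_le (s : Finset ι) {F : (ι → X) → ℝ} (hFm : Measurable F) {cF CF : ℝ}
    (hcF : 0 < cF) (hFlo : ∀ ω, cF ≤ F ω) (hFhi : ∀ ω, F ω ≤ CF) (ω : ι → X) :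
    0 < coordAvg μ s F ω ∧ cF ≤ coordAvg μ s F ω ∧ coordAvg μ s F ω ≤ CF := by
  have h := coordAvg_mem_Icc μ s hFm hFlo hFhi ω
  exact ⟨hcF.trans_le h.1, h.1, h.2⟩

omit [Fintype ι] [DecidableEq ι] [MeasurableSpace X] [IsProbabilityMeasure μ] in
/-- The product of squeezed conditionals along a block is squeezed. [ours] -/
theorem arProd_bounds {q : ι → (ι → X) → ℝ} {cq Cq : ℝ} (hcq : 0 < cq) (hqlo : ∀ a ω, cq ≤ q a ω)
    (hqhi : ∀ a ω, q a ω ≤ Cq) (ω : ι → X) :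
    ∀ l : List ι, cq ^ l.length ≤ (l.map fun b => q b ω).prod ∧ (l.map fun b => q b ω).prod ≤ Cq ^ l.length := by
  intro l
  induction l with
  | nil => simp
  | cons b l' ih =>
    simp only [List.map_cons, List.prod_cons, List.length_cons, pow_succ']
    have h0 : 0 ≤ (l'.map fun b => q b ω).prod := (pow_pos hcq _).le.trans ih.1
    exact ⟨mul_le_mul (hqlo b ω) ih.1 (pow_pos hcq _).le (hcq.le.trans (hqlo b ω)),
      mul_le_mul (hqhi b ω) ih.2 h0 ((hcq.le.trans (hqlo b ω)).trans (hqhi b ω))⟩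

/-- Quotient of squeezed quantities is squeezed. [folklore] -/
theorem div_mem_bounds {x y lx ux ly uy : ℝ} (hlx : 0 < lx) (hly : 0 < ly) (hx1 : lx ≤ x) (hx2 : x ≤ ux)
    (hy1 : ly ≤ y) (hy2 : y ≤ uy) : lx / uy ≤ x / y ∧ x / y ≤ ux / ly := by
  have hy0 : 0 < y := hly.trans_le hy1
  exact ⟨div_le_div₀ (hlx.le.trans hx1) hx1 hy0 hy2, div_le_div₀ ((hlx.le.trans hx1).trans hx2) hx2 hly hy1⟩

omit [DecidableEq ι] [IsProbabilityMeasure μ] in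
/-- `(F/Z)·log g` is integrable when `F` is bounded and `g` is squeezed between positive constants. [ours] -/
theorem integrable_weight_mul_log [IsFiniteMeasure μ] {F g : (ι → X) → ℝ} (hFm : Measurable F) {CF : ℝ}
    (hFb : ∀ ω, |F ω| ≤ CF) (Z : ℝ) (hgm : Measurable g) {lo hi : ℝ} (hlo : 0 < lo)
    (hglo : ∀ ω, lo ≤ g ω) (hghi : ∀ ω, g ω ≤ hi) :
    Integrable (fun ω => F ω / Z * Real.log (g ω)) (Measure.pi fun _ : ι => μ) := by
  refine integrable_pi_of_abs_le μ ((hFm.div_const Z).mul (Real.measurable_log.comp hgm))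
    (C := |CF / Z| * (hi + lo⁻¹)) (fun ω => ?_)
  have hg : 0 < g ω := hlo.trans_le (hglo ω)
  rw [abs_mul]
  refine mul_le_mul ?_ ((Literature.NumberTheory.Automorphic.abs_log_le_add_inv hg).trans (add_le_add (hghi ω) ?_)) (abs_nonneg _)
    (abs_nonneg _)
  · rw [abs_div, abs_div]
    exact div_le_div_of_nonneg_right ((hFb ω).trans (le_abs_self CF)) (abs_nonneg Z)
  · exact inv_anti₀ hlo (hglo ω)

omit [DecidableEq ι] [IsProbabilityMeasure μ] in
/-- List sums pass under the integral (with integrability of the sum). [folklore] -/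
theorem integral_list_map_sum {α : Type*} (L : List α) (f : α → (ι → X) → ℝ)
    (hf : ∀ c ∈ L, Integrable (f c) (Measure.pi fun _ : ι => μ)) :
    ∫ ω, (L.map fun c => f c ω).sum ∂Measure.pi (fun _ : ι => μ) =
        (L.map fun c => ∫ ω, f c ω ∂Measure.pi (fun _ : ι => μ)).sum ∧
      Integrable (fun ω => (L.map fun c => f c ω).sum) (Measure.pi fun _ : ι => μ) := by
  induction L with
  | nil => simp
  | cons c L' ih =>
    have hc := hf c List.mem_cons_self
    have ih' := ih (fun c' hc' => hf c' (List.mem_cons_of_mem c hc'))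
    simp only [List.map_cons, List.sum_cons]
    exact ⟨by rw [integral_add hc ih'.2, ih'.1], hc.add ih'.2⟩

omit [Fintype ι] [DecidableEq ι] [MeasurableSpace X] [IsProbabilityMeasure μ] in
/-- Along `l.zip l.tails.tail` every pair `(a_k, [a_{k+1},…])` inherits the pairwise relation. [ours] -/
theorem rel_of_mem_zip_tails {R : ι → ι → Prop} :
    ∀ l : List ι, l.Pairwise R → ∀ c ∈ l.zip l.tails.tail, ∀ b ∈ c.2, R c.1 b := by
  intro l
  induction l with
  | nil => intro _ c hc; simp at hc
  | cons a l' ih =>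
    intro hpw c hc
    have htails : l'.tails = l' :: l'.tails.tail := by cases l' <;> rfl
    have hzip : ((a :: l').zip (a :: l').tails.tail) = (a, l') :: (l'.zip l'.tails.tail) := by
      rw [List.tails_cons, List.tail_cons, htails, List.zip_cons_cons, ← htails]
    rw [hzip] at hc
    rw [List.pairwise_cons] at hpw
    rcases List.mem_cons.1 hc with h | h
    · subst h; exact hpw.1
    · exact ih hpw.2 c h

omit [Fintype ι] [MeasurableSpace X] [IsProbabilityMeasure μ] in
/-- Update-blindness to every coordinate of a list is piecewise-blindness to its `toFinset`. [ours] -/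
theorem blind_piecewise_of_forall_update {α : Type*} {g : (ι → X) → α} :
    ∀ t : List ι, (∀ b ∈ t, ∀ ω v, g (update ω b v) = g ω) →
      ∀ ω ω', g (t.toFinset.piecewise ω' ω) = g ω := by
  intro t
  induction t with
  | nil => intro _ ω ω'; simp
  | cons b t' ih =>
    intro h ω ω'
    rw [List.toFinset_cons, Finset.piecewise_insert, h b List.mem_cons_self,
      ih (fun c hc => h c (List.mem_cons_of_mem b hc))]

/-! ## §1 Pointwise telescoping -/

omit [Fintype ι] [DecidableEq ι] [MeasurableSpace X] [IsProbabilityMeasure μ] in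
/-- The product of positive conditionals is positive. [ours] -/
theorem arProd_pos {q : ι → (ι → X) → ℝ} (hq0 : ∀ a ω, 0 < q a ω) (l : List ι) (ω : ι → X) :
    0 < (l.map fun b => q b ω).prod := by
  induction l with
  | nil => simp
  | cons b l' ih => simpa only [List.map_cons, List.prod_cons] using mul_pos (hq0 b ω) ih

/-- **Pointwise telescoping**: with `N_k = A_{s_k}F` along the block,
`log(F/((∏_k q_{a_k})·A_{s_0}F)) = Σ_k log(N_k/(q_{a_k}·N_{k−1}))`. [ours] -/
theorem log_arHybrid_telescope {q : ι → (ι → X) → ℝ} (hq0 : ∀ a ω, 0 < q a ω)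
    {F : (ι → X) → ℝ} (hFm : Measurable F) {cF CF : ℝ} (hcF : 0 < cF) (hFlo : ∀ ω, cF ≤ F ω)
    (hFhi : ∀ ω, F ω ≤ CF) (ω : ι → X) :
    ∀ l : List ι, Real.log (F ω / ((l.map fun b => q b ω).prod * coordAvg μ l.toFinset F ω)) =
      ((l.zip l.tails.tail).map fun c : ι × List ι =>
        Real.log (coordAvg μ c.2.toFinset F ω /
          (q c.1 ω * coordAvg μ (c.1 :: c.2).toFinset F ω))).sum := by
  intro l
  induction l with
  | nil =>
    have hF : F ω ≠ 0 := (hcF.trans_le (hFlo ω)).ne'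
    simp [coordAvg_empty, div_self hF]
  | cons a l' ih =>
    have htails : l'.tails = l' :: l'.tails.tail := by cases l' <;> rfl
    have hzip : ((a :: l').zip (a :: l').tails.tail) = (a, l') :: (l'.zip l'.tails.tail) := by
      rw [List.tails_cons, List.tail_cons, htails, List.zip_cons_cons, ← htails]
    rw [hzip]
    simp only [List.map_cons, List.sum_cons, List.prod_cons]
    rw [← ih]
    have hF : 0 < F ω := hcF.trans_le (hFlo ω)
    have hP : 0 < (l'.map fun b => q b ω).prod := arProd_pos hq0 l' ω
    have hN' : 0 < coordAvg μ l'.toFinset F ω := (coordAvg_pos_of_le μ _ hFm hcF hFlo hFhi ω).1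
    have hM : 0 < coordAvg μ (a :: l').toFinset F ω := (coordAvg_pos_of_le μ _ hFm hcF hFlo hFhi ω).1
    have hq : 0 < q a ω := hq0 a ω
    rw [← Real.log_mul (div_pos hN' (mul_pos hq hM)).ne' (div_pos hF (mul_pos hP hN')).ne']
    congr 1
    field_simp

/-! ## §2 Each summand is a mean conditional divergence, and is non-negative -/

/-- **`0 ≤ ∫ (F/Z)·log(A_s F/(q·A_{insert a s}F)) dπ`** (`Z = ∫F dπ`): the mean, over the exact context
law, of the relative entropy of the exact conditional of `a` with respect to the proposal's conditional
`q` — `q` squeezed between positive constants, measurable, normalised in `a`, blind to the coordinates of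
`s`; `F` squeezed between positive constants. [ours] -/
theorem integral_condKL_nonneg (s : Finset ι) {a : ι} {F q : (ι → X) → ℝ} (hFm : Measurable F)
    {cF CF : ℝ} (hcF : 0 < cF) (hFlo : ∀ ω, cF ≤ F ω) (hFhi : ∀ ω, F ω ≤ CF)
    (hqm : Measurable q) {cq Cq : ℝ} (hcq : 0 < cq) (hqlo : ∀ ω, cq ≤ q ω) (hqhi : ∀ ω, q ω ≤ Cq)
    (hq1 : ∀ ω, ∫ v, q (update ω a v) ∂μ = 1) (hqs : ∀ ω ω', q (s.piecewise ω' ω) = q ω) :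
    0 ≤ ∫ ω, F ω / (∫ η, F η ∂Measure.pi (fun _ : ι => μ)) *
        Real.log (coordAvg μ s F ω / (q ω * coordAvg μ (insert a s) F ω)) ∂Measure.pi (fun _ : ι => μ) := by
  obtain ⟨x₀⟩ := MeasureTheory.nonempty_of_isProbabilityMeasure μ
  have ω₀ : ι → X := fun _ => x₀
  set Z : ℝ := ∫ η, F η ∂Measure.pi (fun _ : ι => μ) with hZdef
  set N := coordAvg μ s F with hN
  set M := coordAvg μ (insert a s) F with hM
  have hF0 : ∀ ω, 0 < F ω := fun ω => hcF.trans_le (hFlo ω)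
  have hFabs : ∀ ω, |F ω| ≤ CF := fun ω => by rw [abs_of_pos (hF0 ω)]; exact hFhi ω
  have hNf := fun ω => coordAvg_pos_of_le μ s hFm hcF hFlo hFhi ω
  have hMf := fun ω => coordAvg_pos_of_le μ (insert a s) hFm hcF hFlo hFhi ω
  have hNm : Measurable N := measurable_coordAvg μ s hFm
  have hMm : Measurable M := measurable_coordAvg μ (insert a s) hFm
  have hMb : ∀ ω, |M ω| ≤ CF := abs_coordAvg_le_of_abs_le μ (insert a s) hFm hFabs
  have hq0 : ∀ ω, 0 < q ω := fun ω => hcq.trans_le (hqlo ω)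
  have hqabs : ∀ ω, |q ω| ≤ Cq := fun ω => by rw [abs_of_pos (hq0 ω)]; exact hqhi ω
  have hCq : 0 < Cq := (hq0 ω₀).trans_le (hqhi ω₀)
  have hCF : 0 < CF := (hF0 ω₀).trans_le (hFhi ω₀)
  have hZpos : 0 < Z := by
    have h1 : ∫ _, cF ∂Measure.pi (fun _ : ι => μ) ≤ Z :=
      integral_mono (integrable_const cF) (integrable_pi_of_abs_le μ hFm hFabs) hFlo
    have h2 : ∫ _, cF ∂Measure.pi (fun _ : ι => μ) = cF := by
      rw [integral_const, smul_eq_mul, Measure.real, measure_univ, ENNReal.toReal_one, one_mul]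
    linarith
  -- the ratio `R = q·M/N`: positive, squeezed, measurable, blind to the coordinates of `s`
  set R : (ι → X) → ℝ := fun ω => q ω * M ω / N ω with hR
  have hRm : Measurable R := (hqm.mul hMm).div hNm
  have hRbd : ∀ ω, cq * cF / CF ≤ R ω ∧ R ω ≤ Cq * CF / cF := fun ω =>
    div_mem_bounds (mul_pos hcq hcF) hcF
      (mul_le_mul (hqlo ω) (hMf ω).2.1 hcF.le (hq0 ω).le)
      (mul_le_mul (hqhi ω) (hMf ω).2.2 (hMf ω).1.le hCq.le) (hNf ω).2.1 (hNf ω).2.2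
  have hRpos : ∀ ω, 0 < R ω := fun ω => (div_pos (mul_pos hcq hcF) hCF).trans_le (hRbd ω).1
  have hRabs : ∀ ω, |R ω| ≤ Cq * CF / cF := fun ω => by rw [abs_of_pos (hRpos ω)]; exact (hRbd ω).2
  have hMs : ∀ ω ω', M (s.piecewise ω' ω) = M ω := fun ω ω' => by
    have e : (insert a s).piecewise ω' (s.piecewise ω' ω) = (insert a s).piecewise ω' ω :=
      Finset.piecewise_piecewise_of_subset_right (Finset.subset_insert a s) _ _ _
    rw [hM, ← coordAvg_apply_piecewise μ (insert a s) F (s.piecewise ω' ω) ω', e,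
      coordAvg_apply_piecewise]
  have hRs : ∀ ω ω', R (s.piecewise ω' ω) = R ω := fun ω ω' => by
    simp only [hR, hN, hqs, hMs, coordAvg_apply_piecewise]
  -- pointwise: `(F/Z)(1 − R) ≤ (F/Z)·log(N/(qM))` since `log(N/(qM)) = −log R ≥ 1 − R`
  have hpt : ∀ ω, F ω / Z * (1 - R ω) ≤ F ω / Z * Real.log (N ω / (q ω * M ω)) := by
    intro ω
    have hlog : Real.log (R ω) ≤ R ω - 1 := Real.log_le_sub_one_of_pos (hRpos ω)
    have e : Real.log (N ω / (q ω * M ω)) = -Real.log (R ω) := by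
      rw [← Real.log_inv]
      congr 1
      simp only [hR, inv_div]
    rw [e]
    exact mul_le_mul_of_nonneg_left (by linarith) (div_nonneg (hF0 ω).le hZpos.le)
  -- integrability of both sides
  have hgbd : ∀ ω, cF / (Cq * CF) ≤ N ω / (q ω * M ω) ∧ N ω / (q ω * M ω) ≤ CF / (cq * cF) := fun ω =>
    div_mem_bounds hcF (mul_pos hcq hcF) (hNf ω).2.1 (hNf ω).2.2
      (mul_le_mul (hqlo ω) (hMf ω).2.1 hcF.le (hq0 ω).le)
      (mul_le_mul (hqhi ω) (hMf ω).2.2 (hMf ω).1.le hCq.le)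
  have hIlog : Integrable (fun ω => F ω / Z * Real.log (N ω / (q ω * M ω))) (Measure.pi fun _ : ι => μ) :=
    integrable_weight_mul_log μ hFm hFabs Z (hNm.div (hqm.mul hMm)) (div_pos hcF (mul_pos hCq hCF))
      (fun ω => (hgbd ω).1) (fun ω => (hgbd ω).2)
  have hIlow : Integrable (fun ω => F ω / Z * (1 - R ω)) (Measure.pi fun _ : ι => μ) :=
    integrable_pi_of_abs_le μ ((hFm.div_const Z).mul (measurable_const.sub hRm))
      (C := CF / Z * (1 + Cq * CF / cF)) (fun ω => by
        rw [abs_mul, abs_div, abs_of_pos (hF0 ω), abs_of_pos hZpos]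
        refine mul_le_mul (div_le_div_of_nonneg_right (hFhi ω) hZpos.le)
          ((abs_sub _ _).trans (add_le_add (by rw [abs_one]) (hRabs ω))) (abs_nonneg _)
          (div_nonneg hCF.le hZpos.le))
  -- the lower integral vanishes: `∫ F·R = ∫ R·A_s F = ∫ q·M = ∫ M = ∫ F = Z`
  have hFR : ∫ ω, F ω * R ω ∂Measure.pi (fun _ : ι => μ) = Z := by
    calc ∫ ω, F ω * R ω ∂Measure.pi (fun _ : ι => μ)
        = ∫ ω, R ω * F ω ∂Measure.pi (fun _ : ι => μ) := by simp_rw [mul_comm]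
      _ = ∫ ω, R ω * N ω ∂Measure.pi (fun _ : ι => μ) := pi_integral_mul_coordAvg μ s hFm hFabs hRm hRabs hRs
      _ = ∫ ω, M ω * q ω ∂Measure.pi (fun _ : ι => μ) := by
          refine integral_congr_ae (ae_of_all _ fun ω => ?_)
          show q ω * M ω / N ω * N ω = M ω * q ω
          rw [div_mul_cancel₀ _ (hNf ω).1.ne', mul_comm]
      _ = ∫ ω, M ω ∂Measure.pi (fun _ : ι => μ) :=
          pi_integral_mul_eq_of_normalised μ hqm hqabs hq1 hMm hMb
            (fun ω v => by rw [hM, coordAvg_insert_update])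
      _ = Z := by rw [hM, pi_integral_coordAvg μ (insert a s) hFm hFabs]
  have hlow : ∫ ω, F ω / Z * (1 - R ω) ∂Measure.pi (fun _ : ι => μ) = 0 := by
    have e : ∀ ω, F ω / Z * (1 - R ω) = Z⁻¹ * F ω - Z⁻¹ * (F ω * R ω) := fun ω => by
      rw [div_eq_inv_mul]; ring
    simp_rw [e]
    have hI1 : Integrable (fun ω => Z⁻¹ * F ω) (Measure.pi fun _ : ι => μ) :=
      (integrable_pi_of_abs_le μ hFm hFabs).const_mul Z⁻¹
    have hmFR : Measurable (fun ω => F ω * R ω) := hFm.mul hRm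
    have hI2 : Integrable (fun ω => Z⁻¹ * (F ω * R ω)) (Measure.pi fun _ : ι => μ) :=
      (integrable_pi_of_abs_le μ hmFR (C := CF * (Cq * CF / cF)) (fun ω => by
          rw [abs_mul]
          exact mul_le_mul (hFabs ω) (hRabs ω) (abs_nonneg _) ((abs_nonneg _).trans (hFabs ω)))).const_mul Z⁻¹
    rw [integral_sub hI1 hI2, integral_const_mul, integral_const_mul, hFR, ← hZdef,
      inv_mul_cancel₀ hZpos.ne', sub_self]
  calc (0 : ℝ) = ∫ ω, F ω / Z * (1 - R ω) ∂Measure.pi (fun _ : ι => μ) := hlow.symm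
    _ ≤ _ := integral_mono hIlow hIlog hpt

/-! ## §3 The chain rule -/

/-- **THE KL CHAIN RULE** for the hybrid proposal `H = (∏_k q_{a_k})·A_{s_0}F/Z` of an autoregressive block:
`∫ (F/Z)·log((F/Z)/H) dπ = Σ_k ∫ (F/Z)·log(A_{s_k}F/(q_{a_k}·A_{s_{k−1}}F)) dπ` — the forward relative
entropy is exactly the sum of the mean conditional divergences along the generation order (for this
identity the conditionals need only be positive and squeezed). [ours] -/
theorem integral_kl_arHybrid_eq_sum {q : ι → (ι → X) → ℝ} (hqm : ∀ a, Measurable (q a))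
    {cq Cq : ℝ} (hcq : 0 < cq) (hqlo : ∀ a ω, cq ≤ q a ω) (hqhi : ∀ a ω, q a ω ≤ Cq)
    {F : (ι → X) → ℝ} (hFm : Measurable F) {cF CF : ℝ} (hcF : 0 < cF) (hFlo : ∀ ω, cF ≤ F ω)
    (hFhi : ∀ ω, F ω ≤ CF) (l : List ι) :
    ∫ ω, F ω / (∫ η, F η ∂Measure.pi (fun _ : ι => μ)) *
        Real.log ((F ω / ∫ η, F η ∂Measure.pi (fun _ : ι => μ)) /
          ((l.map fun b => q b ω).prod * coordAvg μ l.toFinset F ω / ∫ η, F η ∂Measure.pi (fun _ : ι => μ)))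
        ∂Measure.pi (fun _ : ι => μ) =
      ((l.zip l.tails.tail).map fun c : ι × List ι =>
        ∫ ω, F ω / (∫ η, F η ∂Measure.pi (fun _ : ι => μ)) *
          Real.log (coordAvg μ c.2.toFinset F ω / (q c.1 ω * coordAvg μ (c.1 :: c.2).toFinset F ω))
          ∂Measure.pi (fun _ : ι => μ)).sum := by
  obtain ⟨x₀⟩ := MeasureTheory.nonempty_of_isProbabilityMeasure μ
  have ω₀ : ι → X := fun _ => x₀
  set Z : ℝ := ∫ η, F η ∂Measure.pi (fun _ : ι => μ) with hZdef
  have hF0 : ∀ ω, 0 < F ω := fun ω => hcF.trans_le (hFlo ω)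
  have hFabs : ∀ ω, |F ω| ≤ CF := fun ω => by rw [abs_of_pos (hF0 ω)]; exact hFhi ω
  have hq0 : ∀ a ω, 0 < q a ω := fun a ω => hcq.trans_le (hqlo a ω)
  have hCF : 0 < CF := (hF0 ω₀).trans_le (hFhi ω₀)
  have hZpos : 0 < Z := by
    have h1 : ∫ _, cF ∂Measure.pi (fun _ : ι => μ) ≤ Z :=
      integral_mono (integrable_const cF) (integrable_pi_of_abs_le μ hFm hFabs) hFlo
    have h2 : ∫ _, cF ∂Measure.pi (fun _ : ι => μ) = cF := by
      rw [integral_const, smul_eq_mul, Measure.real, measure_univ, ENNReal.toReal_one, one_mul]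
    linarith
  -- every summand is integrable (uniform squeeze of the ratio)
  have hterm : ∀ c : ι × List ι, Integrable (fun ω => F ω / Z *
      Real.log (coordAvg μ c.2.toFinset F ω / (q c.1 ω * coordAvg μ (c.1 :: c.2).toFinset F ω)))
      (Measure.pi fun _ : ι => μ) := by
    intro c
    have hCq : 0 < Cq := (hq0 c.1 ω₀).trans_le (hqhi c.1 ω₀)
    have hbd : ∀ ω, cF / (Cq * CF) ≤
        coordAvg μ c.2.toFinset F ω / (q c.1 ω * coordAvg μ (c.1 :: c.2).toFinset F ω) ∧
        coordAvg μ c.2.toFinset F ω / (q c.1 ω * coordAvg μ (c.1 :: c.2).toFinset F ω) ≤ CF / (cq * cF) := by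
      intro ω
      have hN := coordAvg_pos_of_le μ c.2.toFinset hFm hcF hFlo hFhi ω
      have hM := coordAvg_pos_of_le μ (c.1 :: c.2).toFinset hFm hcF hFlo hFhi ω
      exact div_mem_bounds hcF (mul_pos hcq hcF) hN.2.1 hN.2.2
        (mul_le_mul (hqlo c.1 ω) hM.2.1 hcF.le (hq0 c.1 ω).le)
        (mul_le_mul (hqhi c.1 ω) hM.2.2 hM.1.le hCq.le)
    exact integrable_weight_mul_log μ hFm hFabs Z
      ((measurable_coordAvg μ _ hFm).div ((hqm c.1).mul (measurable_coordAvg μ _ hFm)))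
      (div_pos hcF (mul_pos hCq hCF)) (fun ω => (hbd ω).1) (fun ω => (hbd ω).2)
  -- pointwise: cancel `Z`, telescope, distribute the factor `F/Z`
  have hpt : ∀ ω, F ω / Z * Real.log ((F ω / Z) /
      ((l.map fun b => q b ω).prod * coordAvg μ l.toFinset F ω / Z)) =
      ((l.zip l.tails.tail).map fun c : ι × List ι => F ω / Z *
        Real.log (coordAvg μ c.2.toFinset F ω / (q c.1 ω * coordAvg μ (c.1 :: c.2).toFinset F ω))).sum := by
    intro ω
    rw [div_div_div_cancel_right₀ hZpos.ne', log_arHybrid_telescope μ hq0 hFm hcF hFlo hFhi ω l,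
      ← List.sum_map_mul_left]
  rw [integral_congr_ae (ae_of_all _ hpt)]
  exact (integral_list_map_sum μ (l.zip l.tails.tail) (fun c ω => F ω / Z *
    Real.log (coordAvg μ c.2.toFinset F ω / (q c.1 ω * coordAvg μ (c.1 :: c.2).toFinset F ω)))
    (fun c _ => hterm c)).1

/-- **The forward relative entropy of an autoregressive hybrid is the sum of non-negative conditional
terms, hence `≥ 0` termwise**: under the hypotheses of the chain rule with, in addition, each `q_{a_k}`
normalised in `a_k` and not reading `a_{k+1},…,a_m`, every summand is `≥ 0` and so is the total. [ours] -/
theorem integral_kl_arHybrid_nonneg {q : ι → (ι → X) → ℝ} (hqm : ∀ a, Measurable (q a))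
    {cq Cq : ℝ} (hcq : 0 < cq) (hqlo : ∀ a ω, cq ≤ q a ω) (hqhi : ∀ a ω, q a ω ≤ Cq)
    (hq1 : ∀ a ω, ∫ v, q a (update ω a v) ∂μ = 1)
    {F : (ι → X) → ℝ} (hFm : Measurable F) {cF CF : ℝ} (hcF : 0 < cF) (hFlo : ∀ ω, cF ≤ F ω)
    (hFhi : ∀ ω, F ω ≤ CF) (l : List ι)
    (hpw : l.Pairwise (fun a b => ∀ ω v, q a (update ω b v) = q a ω)) :
    (∀ c ∈ l.zip l.tails.tail, 0 ≤ ∫ ω, F ω / (∫ η, F η ∂Measure.pi (fun _ : ι => μ)) *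
        Real.log (coordAvg μ c.2.toFinset F ω / (q c.1 ω * coordAvg μ (c.1 :: c.2).toFinset F ω))
        ∂Measure.pi (fun _ : ι => μ)) ∧
      0 ≤ ∫ ω, F ω / (∫ η, F η ∂Measure.pi (fun _ : ι => μ)) *
        Real.log ((F ω / ∫ η, F η ∂Measure.pi (fun _ : ι => μ)) /
          ((l.map fun b => q b ω).prod * coordAvg μ l.toFinset F ω / ∫ η, F η ∂Measure.pi (fun _ : ι => μ)))
        ∂Measure.pi (fun _ : ι => μ) := by
  have hterms : ∀ c ∈ l.zip l.tails.tail, 0 ≤ ∫ ω, F ω / (∫ η, F η ∂Measure.pi (fun _ : ι => μ)) *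
      Real.log (coordAvg μ c.2.toFinset F ω / (q c.1 ω * coordAvg μ (c.1 :: c.2).toFinset F ω))
      ∂Measure.pi (fun _ : ι => μ) := by
    intro c hc
    have hblind : ∀ ω ω', q c.1 (c.2.toFinset.piecewise ω' ω) = q c.1 ω :=
      blind_piecewise_of_forall_update c.2 (rel_of_mem_zip_tails l hpw c hc)
    simp only [List.toFinset_cons]
    exact integral_condKL_nonneg μ c.2.toFinset hFm hcF hFlo hFhi (hqm c.1) hcq (hqlo c.1) (hqhi c.1)
      (hq1 c.1) hblind
  refine ⟨hterms, ?_⟩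
  rw [integral_kl_arHybrid_eq_sum μ hqm hcq hqlo hqhi hFm hcF hFlo hFhi l]
  refine List.sum_nonneg ?_
  intro x hx
  obtain ⟨c, hc, rfl⟩ := List.mem_map.1 hx
  exact hterms c hc

end Summit.Ventures.LatticeQCDFlow.Theory2.Autoregressive

end
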